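import Summits.BirchSwinnertonDyer.BirchSwinnertonDyer.Theorems.KatoDescentTamePotSupersingularCartanMuRoadDoorsTprimeFive
import Literature.NumberTheory.EllipticCurves.FineSelmerMuRoadSplitCartanFiveIndexTwoAbelian
import Literature.NumberTheory.IwasawaTheory.ClassicalMuInvariantOnePrimeProofs
import HarnessLib

/-!
# KT `p = 5` INDEX-2 split-Cartan μ-road (`G₁₆ ≅ M₁₆`, row 446400hu1) WITHOUT Ferrero–Washington: the (A) / U₀ doors from the five leaves
# `ℚ(P₁)`, `K″ = L^⟨σ̄_a⁴, σ̄_s⟩`, `Z = L^⟨σ̄_a²σ̄_s⟩ = ℚ(ζ₅)`, `L^⟨σ̄_a⟩`, `L^⟨σ̄_a², σ̄_aσ̄_s⟩` — μ-form and CLASS-DATA form (five Iwasawa-1956 certificates)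
# (cell `bsd-potss`, seat `bsd-potss-k8t-c4` g24; route-free; `--supports stmt-BirchSwinnertonDyer-19982 --as helper`; closes nothing)

HONEST FRAMING. Route-free THEOREMS ONLY (no definition, no named fact, no `sorry`). k8t-c4 g18's one-leaf door
`CartanMuRoadDoorsTprimeFive.missingUpperBoundAt_five_tame_of_splitCartanIndexTwoBasis_of_mu` displays `hCS` (a tree theorem since g22) and `hFW`
(Ferrero–Washington, used on the abelian supports `L^⟨−1⟩`, `L^⟨−1, σ̄_s⟩`). By `Literature/…/ClassicalMuVanishesSplitCartanFiveIndexTwoAbelian` (g24) those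
supports are Kuroda consequences of four ABELIAN leaves — the cyclic quartic `K″`, `Z = ℚ(ζ₅)` and the two quadratic subfields of `L = ℚ(W[5])` outside
`ℚ(P₁)` — so (A) at `(W,5)` follows from `ℚ(P₁)` + four abelian leaves with NO named fact (§1, μ-form) and from five Iwasawa-1956 certificates
«`5 ∤ h`, one prime above `5`» (§2, class-data form; Iwasawa 1956 PROVED: `iwasawa1956_…_holds`); U₀ modulo `hKatoA hGZK hmod` only. On 446400hu1
(kit j328433 / j328436, every admissible pair `(a, s)`): `K″ = x⁴−10x²−15x−5` (h = 1), `Z ≅ ℚ(ζ₅)` (h = 1), the two quadratic leaves are `ℚ(√−3)` (h = 1) and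
`ℚ(√−15)` (h = 2) in a pair-dependent order, `ℚ(P₁) = x⁸−120x⁴−360x²+720` (h = 2) — all with one prime above 5. Nothing is asserted about any curve; (A), Conjecture A and BSD are
proved for no curve here. [cite: Kato2004Asterisque, Thm. 14.5 (3) (p. 236), Thm. 12.5 (3) (p. 222)] [cite: CoatesSujatha2005, Thm. 3.4 (§3)]
[cite: Greenberg2001IwasawaPastPresent, Prop. (2.1) (p. 339)] [cite: Serre1972, §2.2] [cite: Washington1997, §13.1] [cite: Lemmermeyer1994, §1]
-/

set_option linter.dupNamespace false
set_option autoImplicit false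

noncomputable section

open scoped Classical NumberField Matrix
open Field IntermediateField WeierstrassCurve Literature.NumberTheory.EllipticCurves
  Literature.NumberTheory.EllipticCurves.Rank1Residual
  Literature.NumberTheory.EllipticCurves.Rank1Residual.Typed
  Literature.NumberTheory.GaloisRepresentations Literature.NumberTheory.SerreUniformity
  Literature.NumberTheory.IwasawaTheory
  Summit.BirchSwinnertonDyer.Rank1Residual Summit.BirchSwinnertonDyer.Rank1Residual.Additive

namespace Summit.BirchSwinnertonDyer.BirchSwinnertonDyer.Theorems.CartanMuRoadSplitFiveIndexTwoAbelDoors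

/-! ### §1 (A) and U₀ at an index-2 `5Ns` row from the basis data and FIVE μ-hypotheses — NO named fact for (A) -/

section MuForm

variable (W : WeierstrassCurve ℚ) [W.IsElliptic]

/-- **(A) at `(W,5)` on an index-2 `5Ns` row (`G₁₆ ≅ M₁₆`) from five classical `μ`-hypotheses — NO named fact** (route-free re-export of
`CoatesSujatha2005.fineSelmerDual_moduleFinite_of_splitCartanIndexTwoBasis_five_abelian`). CONDITIONAL on the displayed data; (A) asserted for no curve.
[cite: CoatesSujatha2005, Thm. 3.4 (§3)] [cite: Serre1972, §2.2] [cite: Washington1997, §13.1] [cite: Lemmermeyer1994, §1] -/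
theorem conjA_five_of_splitCartanIndexTwoBasis_of_mu5 [Fact (5 : ℕ).Prime]
    (e : W.geomTorsion (5 : ℕ) ≃+ (Fin 2 → ZMod 5))
    (he : ∀ σ : absoluteGaloisGroup ℚ, ∃ M ∈ splitCartanNormalizer 5, (M 1 1 = M 0 0 ∨ M 1 1 = 4 * M 0 0) ∧
      (M 1 0 = 2 * M 0 1 ∨ M 1 0 = 3 * M 0 1) ∧ ∀ P : W.geomTorsion (5 : ℕ), e (σ • P) = M *ᵥ e P)
    (σs σa : absoluteGaloisGroup ℚ) (hσs : ∀ P : W.geomTorsion (5 : ℕ), e (σs • P) = !![1, 0; 0, 4] *ᵥ e P)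
    (hσa : ∀ P : W.geomTorsion (5 : ℕ), e (σa • P) = !![0, 1; 2, 0] *ᵥ e P)
    (hμP : ∀ κE : ZpExtension ↥(fixedField (Subgroup.zpowers (absRestrictNormalHom (W.divisionField 5) σs))) 5,
      κE.IsCyclotomic → ClassicalMuVanishes κE)
    (hμK : ∀ κE : ZpExtension ↥(fixedField (Subgroup.zpowers (absRestrictNormalHom (W.divisionField 5) σa * absRestrictNormalHom (W.divisionField 5) σa *
        (absRestrictNormalHom (W.divisionField 5) σa * absRestrictNormalHom (W.divisionField 5) σa)) ⊔ Subgroup.zpowers (absRestrictNormalHom (W.divisionField 5) σs))) 5,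
      κE.IsCyclotomic → ClassicalMuVanishes κE)
    (hμZ : ∀ κE : ZpExtension ↥(fixedField (Subgroup.zpowers (absRestrictNormalHom (W.divisionField 5) σa * absRestrictNormalHom (W.divisionField 5) σa *
        absRestrictNormalHom (W.divisionField 5) σs))) 5,
      κE.IsCyclotomic → ClassicalMuVanishes κE)
    (hμQ : ∀ κE : ZpExtension ↥(fixedField (Subgroup.zpowers (absRestrictNormalHom (W.divisionField 5) σa))) 5,
      κE.IsCyclotomic → ClassicalMuVanishes κE)
    (hμR : ∀ κE : ZpExtension ↥(fixedField (Subgroup.zpowers (absRestrictNormalHom (W.divisionField 5) σa * absRestrictNormalHom (W.divisionField 5) σa) ⊔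
        Subgroup.zpowers (absRestrictNormalHom (W.divisionField 5) σa * absRestrictNormalHom (W.divisionField 5) σs))) 5,
      κE.IsCyclotomic → ClassicalMuVanishes κE)
    (κ : ZpExtension ℚ 5) (hκ : κ.IsCyclotomic) :
    ∃ (γ : absoluteGaloisGroup ℚ) (D : W.FineSelmerDualData κ γ),
      Module.Finite ℤ_[5] (RestrictScalars ℤ_[5] (IwasawaAlgebra 5) D.X) :=
  CoatesSujatha2005.fineSelmerDual_moduleFinite_of_splitCartanIndexTwoBasis_five_abelian W e he σs σa hσs hσa hμP hμK hμZ hμQ hμR κ hκ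

variable [W.IsGloballyMinimal]

/-- **U₀ at an index-2 `5Ns` (t′) row from five classical `μ`-hypotheses**: `MissingUpperBoundAt W 5` for a rank-`0` (t′) row (`Addv W 5`,
`SubTprime W 5`, `W[5]` irreducible) from `hKatoA hGZK hmod` — the only named facts — and (A) from §1. CONDITIONAL; nothing booked; BSD for no curve.
[cite: Kato2004Asterisque, Thm. 14.5 (3) (p. 236), Thm. 12.5 (3) (p. 222)] [cite: CoatesSujatha2005, Thm. 3.4 (§3)] [cite: Washington1997, §13.1] -/
theorem missingUpperBoundAt_five_tame_of_splitCartanIndexTwoBasis_of_mu5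
    (hKatoA : Kato2004.rankZero_padicValNat_sha_add_padicValNat_tamagawa_le_of_additive_potGood_of_irreducible_of_fineSelmerDual_fg)
    (hGZK : rank_eq_analyticRank_of_analyticRank_le_one) (hmod : hasEntireLFunction_rat) [Fact (5 : ℕ).Prime]
    (hr : W.analyticRank = 0) (hadd : Addv W 5) (hT : SubTprime W 5) (hirr : W.HasIrreducibleModPGaloisRep 5)
    (e : W.geomTorsion (5 : ℕ) ≃+ (Fin 2 → ZMod 5))
    (he : ∀ σ : absoluteGaloisGroup ℚ, ∃ M ∈ splitCartanNormalizer 5, (M 1 1 = M 0 0 ∨ M 1 1 = 4 * M 0 0) ∧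
      (M 1 0 = 2 * M 0 1 ∨ M 1 0 = 3 * M 0 1) ∧ ∀ P : W.geomTorsion (5 : ℕ), e (σ • P) = M *ᵥ e P)
    (σs σa : absoluteGaloisGroup ℚ) (hσs : ∀ P : W.geomTorsion (5 : ℕ), e (σs • P) = !![1, 0; 0, 4] *ᵥ e P)
    (hσa : ∀ P : W.geomTorsion (5 : ℕ), e (σa • P) = !![0, 1; 2, 0] *ᵥ e P)
    (hμP : ∀ κE : ZpExtension ↥(fixedField (Subgroup.zpowers (absRestrictNormalHom (W.divisionField 5) σs))) 5,
      κE.IsCyclotomic → ClassicalMuVanishes κE)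
    (hμK : ∀ κE : ZpExtension ↥(fixedField (Subgroup.zpowers (absRestrictNormalHom (W.divisionField 5) σa * absRestrictNormalHom (W.divisionField 5) σa *
        (absRestrictNormalHom (W.divisionField 5) σa * absRestrictNormalHom (W.divisionField 5) σa)) ⊔ Subgroup.zpowers (absRestrictNormalHom (W.divisionField 5) σs))) 5,
      κE.IsCyclotomic → ClassicalMuVanishes κE)
    (hμZ : ∀ κE : ZpExtension ↥(fixedField (Subgroup.zpowers (absRestrictNormalHom (W.divisionField 5) σa * absRestrictNormalHom (W.divisionField 5) σa *
        absRestrictNormalHom (W.divisionField 5) σs))) 5,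
      κE.IsCyclotomic → ClassicalMuVanishes κE)
    (hμQ : ∀ κE : ZpExtension ↥(fixedField (Subgroup.zpowers (absRestrictNormalHom (W.divisionField 5) σa))) 5,
      κE.IsCyclotomic → ClassicalMuVanishes κE)
    (hμR : ∀ κE : ZpExtension ↥(fixedField (Subgroup.zpowers (absRestrictNormalHom (W.divisionField 5) σa * absRestrictNormalHom (W.divisionField 5) σa) ⊔
        Subgroup.zpowers (absRestrictNormalHom (W.divisionField 5) σa * absRestrictNormalHom (W.divisionField 5) σs))) 5,
      κE.IsCyclotomic → ClassicalMuVanishes κE) :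
    MissingUpperBoundAt W 5 :=
  CartanMuRoadDoorsTprimeFive.missingUpperBoundAt_tame_of_conjA W hKatoA hGZK hmod 5 hr (by decide) hadd hT hirr
    (conjA_five_of_splitCartanIndexTwoBasis_of_mu5 W e he σs σa hσs hσa hμP hμK hμZ hμQ hμR)

end MuForm

/-! ### §2 (A) and U₀ at an index-2 `5Ns` row from CLASS DATA: five Iwasawa-1956 certificates — NO named fact for (A) -/

section ClassData

variable (W : WeierstrassCurve ℚ) [W.IsElliptic]

/-- Iwasawa-1956 leaf (PROVED): `5 ∤ h(K)` and one prime of `K` above `5` give `μ = 0` for every `ℤ_5`-extension of `K`.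
[cite: Greenberg2001IwasawaPastPresent, Prop. (2.1) (p. 339)] [cite: Washington1997, §13.1] -/
theorem leafMu_of_classNumber' (K : Type) [Field K] [NumberField K]
    (hh : ¬ 5 ∣ NumberField.classNumber K)
    (hv : ∃! v : IsDedekindDomain.HeightOneSpectrum (𝓞 K), ((5 : ℕ) : 𝓞 K) ∈ v.asIdeal) :
    haveI : Fact (Nat.Prime 5) := ⟨by norm_num⟩
    ∀ κE : ZpExtension K 5, κE.IsCyclotomic → ClassicalMuVanishes κE :=
  haveI : Fact (Nat.Prime 5) := ⟨by norm_num⟩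
  fun κE _ => classicalMuVanishes_of_classNumberPExp_eq_zero
    iwasawa1956_classNumberPExp_eq_zero_of_not_dvd_classNumber_of_unique_prime_holds hh hv κE

/-- **(A) at `(W,5)` on an index-2 `5Ns` row from displayed class data — NO named fact**: the basis data and, for each of the five leaves `ℚ(P₁) = L^⟨σ̄_s⟩`,
`K″ = L^⟨σ̄_a⁴, σ̄_s⟩`, `Z = L^⟨σ̄_a²σ̄_s⟩`, `L^⟨σ̄_a⟩`, `L^⟨σ̄_a², σ̄_aσ̄_s⟩`, the two integers «`5 ∤ h`» and «one prime above `5`» (Iwasawa 1956 PROVED).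
CONDITIONAL on the displayed data; (A) asserted for no curve. [cite: CoatesSujatha2005, Thm. 3.4 (§3)] [cite: Greenberg2001IwasawaPastPresent, Prop. (2.1) (p. 339)]
[cite: Serre1972, §2.2] [cite: Washington1997, §13.1] -/
theorem conjA_five_of_splitCartanIndexTwoBasis_of_classData [Fact (5 : ℕ).Prime]
    (e : W.geomTorsion (5 : ℕ) ≃+ (Fin 2 → ZMod 5))
    (he : ∀ σ : absoluteGaloisGroup ℚ, ∃ M ∈ splitCartanNormalizer 5, (M 1 1 = M 0 0 ∨ M 1 1 = 4 * M 0 0) ∧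
      (M 1 0 = 2 * M 0 1 ∨ M 1 0 = 3 * M 0 1) ∧ ∀ P : W.geomTorsion (5 : ℕ), e (σ • P) = M *ᵥ e P)
    (σs σa : absoluteGaloisGroup ℚ) (hσs : ∀ P : W.geomTorsion (5 : ℕ), e (σs • P) = !![1, 0; 0, 4] *ᵥ e P)
    (hσa : ∀ P : W.geomTorsion (5 : ℕ), e (σa • P) = !![0, 1; 2, 0] *ᵥ e P)
    (hhP : haveI : NumberField ↥(W.divisionField 5) := NumberField.mk
      ¬ 5 ∣ NumberField.classNumber ↥(fixedField (Subgroup.zpowers (absRestrictNormalHom (W.divisionField 5) σs))))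
    (hvP : haveI : NumberField ↥(W.divisionField 5) := NumberField.mk
      ∃! v : IsDedekindDomain.HeightOneSpectrum (𝓞 ↥(fixedField (Subgroup.zpowers (absRestrictNormalHom (W.divisionField 5) σs)))),
        ((5 : ℕ) : 𝓞 ↥(fixedField (Subgroup.zpowers (absRestrictNormalHom (W.divisionField 5) σs)))) ∈ v.asIdeal)
    (hhK : haveI : NumberField ↥(W.divisionField 5) := NumberField.mk
      ¬ 5 ∣ NumberField.classNumber ↥(fixedField (Subgroup.zpowers (absRestrictNormalHom (W.divisionField 5) σa * absRestrictNormalHom (W.divisionField 5) σa *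
        (absRestrictNormalHom (W.divisionField 5) σa * absRestrictNormalHom (W.divisionField 5) σa)) ⊔ Subgroup.zpowers (absRestrictNormalHom (W.divisionField 5) σs))))
    (hvK : haveI : NumberField ↥(W.divisionField 5) := NumberField.mk
      ∃! v : IsDedekindDomain.HeightOneSpectrum (𝓞 ↥(fixedField (Subgroup.zpowers (absRestrictNormalHom (W.divisionField 5) σa * absRestrictNormalHom (W.divisionField 5) σa *
        (absRestrictNormalHom (W.divisionField 5) σa * absRestrictNormalHom (W.divisionField 5) σa)) ⊔ Subgroup.zpowers (absRestrictNormalHom (W.divisionField 5) σs)))),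
        ((5 : ℕ) : 𝓞 ↥(fixedField (Subgroup.zpowers (absRestrictNormalHom (W.divisionField 5) σa * absRestrictNormalHom (W.divisionField 5) σa *
        (absRestrictNormalHom (W.divisionField 5) σa * absRestrictNormalHom (W.divisionField 5) σa)) ⊔ Subgroup.zpowers (absRestrictNormalHom (W.divisionField 5) σs)))) ∈ v.asIdeal)
    (hhZ : haveI : NumberField ↥(W.divisionField 5) := NumberField.mk
      ¬ 5 ∣ NumberField.classNumber ↥(fixedField (Subgroup.zpowers (absRestrictNormalHom (W.divisionField 5) σa * absRestrictNormalHom (W.divisionField 5) σa *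
        absRestrictNormalHom (W.divisionField 5) σs))))
    (hvZ : haveI : NumberField ↥(W.divisionField 5) := NumberField.mk
      ∃! v : IsDedekindDomain.HeightOneSpectrum (𝓞 ↥(fixedField (Subgroup.zpowers (absRestrictNormalHom (W.divisionField 5) σa * absRestrictNormalHom (W.divisionField 5) σa *
        absRestrictNormalHom (W.divisionField 5) σs)))),
        ((5 : ℕ) : 𝓞 ↥(fixedField (Subgroup.zpowers (absRestrictNormalHom (W.divisionField 5) σa * absRestrictNormalHom (W.divisionField 5) σa *
        absRestrictNormalHom (W.divisionField 5) σs)))) ∈ v.asIdeal)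
    (hhQ : haveI : NumberField ↥(W.divisionField 5) := NumberField.mk
      ¬ 5 ∣ NumberField.classNumber ↥(fixedField (Subgroup.zpowers (absRestrictNormalHom (W.divisionField 5) σa))))
    (hvQ : haveI : NumberField ↥(W.divisionField 5) := NumberField.mk
      ∃! v : IsDedekindDomain.HeightOneSpectrum (𝓞 ↥(fixedField (Subgroup.zpowers (absRestrictNormalHom (W.divisionField 5) σa)))),
        ((5 : ℕ) : 𝓞 ↥(fixedField (Subgroup.zpowers (absRestrictNormalHom (W.divisionField 5) σa)))) ∈ v.asIdeal)
    (hhR : haveI : NumberField ↥(W.divisionField 5) := NumberField.mk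
      ¬ 5 ∣ NumberField.classNumber ↥(fixedField (Subgroup.zpowers (absRestrictNormalHom (W.divisionField 5) σa * absRestrictNormalHom (W.divisionField 5) σa) ⊔
        Subgroup.zpowers (absRestrictNormalHom (W.divisionField 5) σa * absRestrictNormalHom (W.divisionField 5) σs))))
    (hvR : haveI : NumberField ↥(W.divisionField 5) := NumberField.mk
      ∃! v : IsDedekindDomain.HeightOneSpectrum (𝓞 ↥(fixedField (Subgroup.zpowers (absRestrictNormalHom (W.divisionField 5) σa * absRestrictNormalHom (W.divisionField 5) σa) ⊔
        Subgroup.zpowers (absRestrictNormalHom (W.divisionField 5) σa * absRestrictNormalHom (W.divisionField 5) σs)))),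
        ((5 : ℕ) : 𝓞 ↥(fixedField (Subgroup.zpowers (absRestrictNormalHom (W.divisionField 5) σa * absRestrictNormalHom (W.divisionField 5) σa) ⊔
        Subgroup.zpowers (absRestrictNormalHom (W.divisionField 5) σa * absRestrictNormalHom (W.divisionField 5) σs)))) ∈ v.asIdeal)
    (κ : ZpExtension ℚ 5) (hκ : κ.IsCyclotomic) :
    ∃ (γ : absoluteGaloisGroup ℚ) (D : W.FineSelmerDualData κ γ),
      Module.Finite ℤ_[5] (RestrictScalars ℤ_[5] (IwasawaAlgebra 5) D.X) :=
  haveI : NumberField ↥(W.divisionField 5) := NumberField.mk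
  conjA_five_of_splitCartanIndexTwoBasis_of_mu5 W e he σs σa hσs hσa
    (leafMu_of_classNumber' _ hhP hvP) (leafMu_of_classNumber' _ hhK hvK) (leafMu_of_classNumber' _ hhZ hvZ)
    (leafMu_of_classNumber' _ hhQ hvQ) (leafMu_of_classNumber' _ hhR hvR) κ hκ

variable [W.IsGloballyMinimal]

/-- **U₀ at an index-2 `5Ns` (t′) row from displayed class data**: `MissingUpperBoundAt W 5` for a rank-`0` (t′) row from `hKatoA hGZK hmod` — the only
named facts — and (A) from §2's five Iwasawa-1956 certificates. CONDITIONAL; nothing booked; BSD for no curve.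
[cite: Kato2004Asterisque, Thm. 14.5 (3) (p. 236), Thm. 12.5 (3) (p. 222)] [cite: CoatesSujatha2005, Thm. 3.4 (§3)] [cite: Greenberg2001IwasawaPastPresent, Prop. (2.1) (p. 339)] -/
theorem missingUpperBoundAt_five_tame_of_splitCartanIndexTwoBasis_of_classData
    (hKatoA : Kato2004.rankZero_padicValNat_sha_add_padicValNat_tamagawa_le_of_additive_potGood_of_irreducible_of_fineSelmerDual_fg)
    (hGZK : rank_eq_analyticRank_of_analyticRank_le_one) (hmod : hasEntireLFunction_rat) [Fact (5 : ℕ).Prime]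
    (hr : W.analyticRank = 0) (hadd : Addv W 5) (hT : SubTprime W 5) (hirr : W.HasIrreducibleModPGaloisRep 5)
    (e : W.geomTorsion (5 : ℕ) ≃+ (Fin 2 → ZMod 5))
    (he : ∀ σ : absoluteGaloisGroup ℚ, ∃ M ∈ splitCartanNormalizer 5, (M 1 1 = M 0 0 ∨ M 1 1 = 4 * M 0 0) ∧
      (M 1 0 = 2 * M 0 1 ∨ M 1 0 = 3 * M 0 1) ∧ ∀ P : W.geomTorsion (5 : ℕ), e (σ • P) = M *ᵥ e P)
    (σs σa : absoluteGaloisGroup ℚ) (hσs : ∀ P : W.geomTorsion (5 : ℕ), e (σs • P) = !![1, 0; 0, 4] *ᵥ e P)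
    (hσa : ∀ P : W.geomTorsion (5 : ℕ), e (σa • P) = !![0, 1; 2, 0] *ᵥ e P)
    (hhP : haveI : NumberField ↥(W.divisionField 5) := NumberField.mk
      ¬ 5 ∣ NumberField.classNumber ↥(fixedField (Subgroup.zpowers (absRestrictNormalHom (W.divisionField 5) σs))))
    (hvP : haveI : NumberField ↥(W.divisionField 5) := NumberField.mk
      ∃! v : IsDedekindDomain.HeightOneSpectrum (𝓞 ↥(fixedField (Subgroup.zpowers (absRestrictNormalHom (W.divisionField 5) σs)))),
        ((5 : ℕ) : 𝓞 ↥(fixedField (Subgroup.zpowers (absRestrictNormalHom (W.divisionField 5) σs)))) ∈ v.asIdeal)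
    (hhK : haveI : NumberField ↥(W.divisionField 5) := NumberField.mk
      ¬ 5 ∣ NumberField.classNumber ↥(fixedField (Subgroup.zpowers (absRestrictNormalHom (W.divisionField 5) σa * absRestrictNormalHom (W.divisionField 5) σa *
        (absRestrictNormalHom (W.divisionField 5) σa * absRestrictNormalHom (W.divisionField 5) σa)) ⊔ Subgroup.zpowers (absRestrictNormalHom (W.divisionField 5) σs))))
    (hvK : haveI : NumberField ↥(W.divisionField 5) := NumberField.mk
      ∃! v : IsDedekindDomain.HeightOneSpectrum (𝓞 ↥(fixedField (Subgroup.zpowers (absRestrictNormalHom (W.divisionField 5) σa * absRestrictNormalHom (W.divisionField 5) σa *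
        (absRestrictNormalHom (W.divisionField 5) σa * absRestrictNormalHom (W.divisionField 5) σa)) ⊔ Subgroup.zpowers (absRestrictNormalHom (W.divisionField 5) σs)))),
        ((5 : ℕ) : 𝓞 ↥(fixedField (Subgroup.zpowers (absRestrictNormalHom (W.divisionField 5) σa * absRestrictNormalHom (W.divisionField 5) σa *
        (absRestrictNormalHom (W.divisionField 5) σa * absRestrictNormalHom (W.divisionField 5) σa)) ⊔ Subgroup.zpowers (absRestrictNormalHom (W.divisionField 5) σs)))) ∈ v.asIdeal)
    (hhZ : haveI : NumberField ↥(W.divisionField 5) := NumberField.mk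
      ¬ 5 ∣ NumberField.classNumber ↥(fixedField (Subgroup.zpowers (absRestrictNormalHom (W.divisionField 5) σa * absRestrictNormalHom (W.divisionField 5) σa *
        absRestrictNormalHom (W.divisionField 5) σs))))
    (hvZ : haveI : NumberField ↥(W.divisionField 5) := NumberField.mk
      ∃! v : IsDedekindDomain.HeightOneSpectrum (𝓞 ↥(fixedField (Subgroup.zpowers (absRestrictNormalHom (W.divisionField 5) σa * absRestrictNormalHom (W.divisionField 5) σa *
        absRestrictNormalHom (W.divisionField 5) σs)))),
        ((5 : ℕ) : 𝓞 ↥(fixedField (Subgroup.zpowers (absRestrictNormalHom (W.divisionField 5) σa * absRestrictNormalHom (W.divisionField 5) σa *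
        absRestrictNormalHom (W.divisionField 5) σs)))) ∈ v.asIdeal)
    (hhQ : haveI : NumberField ↥(W.divisionField 5) := NumberField.mk
      ¬ 5 ∣ NumberField.classNumber ↥(fixedField (Subgroup.zpowers (absRestrictNormalHom (W.divisionField 5) σa))))
    (hvQ : haveI : NumberField ↥(W.divisionField 5) := NumberField.mk
      ∃! v : IsDedekindDomain.HeightOneSpectrum (𝓞 ↥(fixedField (Subgroup.zpowers (absRestrictNormalHom (W.divisionField 5) σa)))),
        ((5 : ℕ) : 𝓞 ↥(fixedField (Subgroup.zpowers (absRestrictNormalHom (W.divisionField 5) σa)))) ∈ v.asIdeal)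
    (hhR : haveI : NumberField ↥(W.divisionField 5) := NumberField.mk
      ¬ 5 ∣ NumberField.classNumber ↥(fixedField (Subgroup.zpowers (absRestrictNormalHom (W.divisionField 5) σa * absRestrictNormalHom (W.divisionField 5) σa) ⊔
        Subgroup.zpowers (absRestrictNormalHom (W.divisionField 5) σa * absRestrictNormalHom (W.divisionField 5) σs))))
    (hvR : haveI : NumberField ↥(W.divisionField 5) := NumberField.mk
      ∃! v : IsDedekindDomain.HeightOneSpectrum (𝓞 ↥(fixedField (Subgroup.zpowers (absRestrictNormalHom (W.divisionField 5) σa * absRestrictNormalHom (W.divisionField 5) σa) ⊔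
        Subgroup.zpowers (absRestrictNormalHom (W.divisionField 5) σa * absRestrictNormalHom (W.divisionField 5) σs)))),
        ((5 : ℕ) : 𝓞 ↥(fixedField (Subgroup.zpowers (absRestrictNormalHom (W.divisionField 5) σa * absRestrictNormalHom (W.divisionField 5) σa) ⊔
        Subgroup.zpowers (absRestrictNormalHom (W.divisionField 5) σa * absRestrictNormalHom (W.divisionField 5) σs)))) ∈ v.asIdeal) :
    MissingUpperBoundAt W 5 :=
  CartanMuRoadDoorsTprimeFive.missingUpperBoundAt_tame_of_conjA W hKatoA hGZK hmod 5 hr (by decide) hadd hT hirr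
    (conjA_five_of_splitCartanIndexTwoBasis_of_classData W e he σs σa hσs hσa hhP hvP hhK hvK hhZ hvZ hhQ hvQ hhR hvR)

end ClassData

end Summit.BirchSwinnertonDyer.BirchSwinnertonDyer.Theorems.CartanMuRoadSplitFiveIndexTwoAbelDoors

end
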